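import Summits.Ventures.PercRepro2.CaseOneGadgetUWA1MixA
import Summits.Ventures.PercRepro2.CaseOneGadgetUWA1MixB
import Summits.Ventures.PercRepro2.CaseOnePendantAnyI

/-!
# The gadget `u ~ {w, a₁}`, `w ~ {u, a₂, o, b}` (uwa1): the bridge from the forms to the polynomials
(blind cell PercRepro2, p1 g22; generated by mining/p1/g22/gen_polyA.py)

`sgA*_mix` (CaseOneGadgetUWA1MixA / MixB): each mass polynomial at the cell masses of the pinned law is the
thirty-two-term mixture of `massgA_*`; hence **`iiExpr_eq_iiA5`**, **`iiExprT_eq_iiqA5`**, **`iExpr_eq_iA5`**,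
**`iExprT_eq_iqA5`**: the four case-1 forms at `u` are the gadget polynomials at the five edge weights and the
cell masses of `pin5A p`. With `iA5 ≥ 0` / `iqA5 ≥ 0` on the cube under `SFacts` (the certificate layer, to come)
they give `(i)`, `(i-Q)` at `u` for every finite graph and every weight vector. -/

namespace Summit.Ventures.PercRepro2

namespace CaseOne

section BridgeA5
variable {V : Type*} {E : Type*} [Fintype E] [DecidableEq E] {R : Type*} [Field R]
variable {ends : E → Sym2 V} {o a₁ a₂ b u w : V} {euw eua1 ewa2 ewo ewb : E}

/-- **`iiExpr` at `u` is `iiA5`** at the five edge weights and the cell masses of the pinned law. -/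
theorem iiExpr_eq_iiA5 (p : E → R) (h : IsGadgetUWA1 ends o a₁ a₂ b u w euw eua1 ewa2 ewo ewb) :
    iiExpr p ends o a₁ a₂ u b =
      iiA5 (p euw) (p eua1) (p ewa2) (p ewo) (p ewb) (scells (pin5A p euw eua1 ewa2 ewo ewb) ends o a₁ a₂ b) := by
  rw [iiExpr_eq_probs, massgA_Q p h, massgA_QB p h, massgA_QA p h, massgA_QAO p h, massgA_QAB p h, massgA_QABO p h,
    massgA_D p h, massgA_Do p h, ← sgAQ_mix p euw eua1 ewa2 ewo ewb, ← sgAQB_mix p euw eua1 ewa2 ewo ewb,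
    ← sgAQA_mix p euw eua1 ewa2 ewo ewb, ← sgAQAO_mix p euw eua1 ewa2 ewo ewb, ← sgAQAB_mix p euw eua1 ewa2 ewo ewb,
    ← sgAQABO_mix p euw eua1 ewa2 ewo ewb, ← sgAD_mix p euw eua1 ewa2 ewo ewb, ← sgADo_mix p euw eua1 ewa2 ewo ewb]
  rfl

/-- **The Q-threshold form at `u` is `iiqA5`**. -/
theorem iiExprT_eq_iiqA5 (p : E → R) (h : IsGadgetUWA1 ends o a₁ a₂ b u w euw eua1 ewa2 ewo ewb) :
    iiExprT p ends o a₁ a₂ u b (Dqo p ends o a₁ a₂) (prob p (connEvent ends a₁ a₂)ᶜ) =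
      iiqA5 (p euw) (p eua1) (p ewa2) (p ewo) (p ewb) (scells (pin5A p euw eua1 ewa2 ewo ewb) ends o a₁ a₂ b) := by
  rw [iiExprT_eq, massgA_Q p h, massgA_QB p h, massgA_QA p h, massgA_QAO p h, massgA_QAB p h, massgA_QABO p h,
    massgA_YU p h, ← sgAQ_mix p euw eua1 ewa2 ewo ewb, ← sgAQB_mix p euw eua1 ewa2 ewo ewb,
    ← sgAQA_mix p euw eua1 ewa2 ewo ewb, ← sgAQAO_mix p euw eua1 ewa2 ewo ewb, ← sgAQAB_mix p euw eua1 ewa2 ewo ewb,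
    ← sgAQABO_mix p euw eua1 ewa2 ewo ewb, ← sgAYU_mix p euw eua1 ewa2 ewo ewb]
  rfl

/-- **`iExpr` at `u` is `iA5`**. -/
theorem iExpr_eq_iA5 (p : E → R) (h : IsGadgetUWA1 ends o a₁ a₂ b u w euw eua1 ewa2 ewo ewb) :
    iExpr p ends o a₁ a₂ u b =
      iA5 (p euw) (p eua1) (p ewa2) (p ewo) (p ewb) (scells (pin5A p euw eua1 ewa2 ewo ewb) ends o a₁ a₂ b) := by
  rw [iExpr_eq_iExprT, iExprT_eq, massgA_Q p h, massgA_QA p h, massgA_QAO p h, massgA_D p h, massgA_Do p h,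
    massgA_QB1 p h, massgA_QAB1 p h, massgA_QAB1O p h, ← sgAQ_mix p euw eua1 ewa2 ewo ewb,
    ← sgAQA_mix p euw eua1 ewa2 ewo ewb, ← sgAQAO_mix p euw eua1 ewa2 ewo ewb, ← sgAD_mix p euw eua1 ewa2 ewo ewb,
    ← sgADo_mix p euw eua1 ewa2 ewo ewb, ← sgAQB1_mix p euw eua1 ewa2 ewo ewb, ← sgAQAB1_mix p euw eua1 ewa2 ewo ewb,
    ← sgAQAB1O_mix p euw eua1 ewa2 ewo ewb]
  rfl

/-- **The `(i)`-side Q-threshold form at `u` is `iqA5`**. -/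
theorem iExprT_eq_iqA5 (p : E → R) (h : IsGadgetUWA1 ends o a₁ a₂ b u w euw eua1 ewa2 ewo ewb) :
    iExprT p ends o a₁ a₂ u b (Dqo p ends o a₁ a₂) (prob p (connEvent ends a₁ a₂)ᶜ) =
      iqA5 (p euw) (p eua1) (p ewa2) (p ewo) (p ewb) (scells (pin5A p euw eua1 ewa2 ewo ewb) ends o a₁ a₂ b) := by
  rw [iExprT_eq, massgA_Q p h, massgA_QA p h, massgA_QAO p h, massgA_YU p h, massgA_QB1 p h, massgA_QAB1 p h,
    massgA_QAB1O p h, ← sgAQ_mix p euw eua1 ewa2 ewo ewb, ← sgAQA_mix p euw eua1 ewa2 ewo ewb,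
    ← sgAQAO_mix p euw eua1 ewa2 ewo ewb, ← sgAYU_mix p euw eua1 ewa2 ewo ewb, ← sgAQB1_mix p euw eua1 ewa2 ewo ewb,
    ← sgAQAB1_mix p euw eua1 ewa2 ewo ewb, ← sgAQAB1O_mix p euw eua1 ewa2 ewo ewb]
  rfl

end BridgeA5

end CaseOne

end Summit.Ventures.PercRepro2
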